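/-
Copyright (c) 2026 the pub-hodgecm-mathlib formalisation cell (harness21).  Prover seat hodgecm-mathlib-F0P3a-p03 (g21), 2026-09-02 (LH7 leaf ED. 3 road, letter O8a, step (4) = (M1)
of `F0/P3a/F0P3a-p03/g21/CENSUS-O8a-PKsaU2.F0P3ap03g21.md`: strong approximation for `SU(antidiag(1,1))` — part A, the adelic unitary transvections).
-/
import Literature.NumberTheory.Automorphic.UnitaryOneOneTransvections           -- ★ p850490 (this seat): the field case (`rational` points)
import Literature.NumberTheory.Automorphic.UnitaryGroupPlaceInclusion             -- ★ `inclPlace`, `inclPlaceAdelic`, `evalPlace`, `eq_of_forall_evalPlace_eq`, `archPart`∕`finPart` plumbing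
import HarnessLib

/-!
# Unitary transvections in `U(antidiag(1,1))(𝔸_F) ≤ GL₂(𝔸_E)`: membership, determinant, rational points, continuity, and the ones supported over one finite place

Registry: pub-hodgecm MODEL-CONSTRUCTION sub-cell; companion of ★ `UnitaryGroupAutomorphicRep` (`rational`, `adelic`, `toAdelic`), ★ `UnitaryGroupPlaceInclusion` and ★ p850490
`UnitaryOneOneTransvections`.  THEOREMS ONLY: no definition, no named fact, no instance, no notation, no `sorry`.  First of the files proving STRONG APPROXIMATION for
`SU(antidiag(1,1)) ≅ SL₂` with one finite place free (the number-theoretic input of the LH7 letter O8a `PKsaU2Shape`; [PlatonovRapinchuk1994] §7.4 Thm. 7.12, [Kneser1966]) by the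
unit-pivot method of ★ `StrongApproximationSL2` run directly inside `U(J)(𝔸_F) ≤ GL₂(𝔸_E)` with UNITARY transvections.

THE MATHEMATICS.  `E ∕ F` number fields, `c ∈ Aut(E ∕ F)`, `J = antidiag(1,1) ∈ M₂(E)`, `σ_𝔸 = c ⊗ 1` on `𝔸_E` (★ `conjAdele`).  For a commutative ring `R` with an endomorphism `σ`
(§1, private helpers: `R = 𝔸_E` is not a field, so ★ p850490's field lemmas are re-run over a commutative ring) the transvection `T_{ij}(x)` (`{i,j} = {0,1}`) lies in
`U(σ, antidiag(1,1))(R)` as soon as `σ x = −x`, has determinant `1` (`det_units_transvectionStruct`), and a determinant-one element `(a b; c d)` of `U(σ, antidiag(1,1))(R)` has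
`σa = a, σb = −b, σc = −c, σd = d`; `x ↦ T_{ij}(x)` is continuous into `GL₂(R)` (`continuous_units_transvection`); `T_{ij}(x).map f = T_{ij}(f x)` (`transvection_map`).  §2 specialises to `U(J)(𝔸_F)` (★ `adelic`): membership
(`units_transvection_mem_adelic`), entries (`entries_of_mem_adelic_of_det_eq_one`), the rational ones are `toAdelic` of rational transvections (`coe_toAdelic_units_transvection`,
`units_transvection_algebraMap_mem_image_toAdelic`).  §3: a unitary adelic transvection whose parameter `z` has
NO archimedean component and finite components only at the places over ONE finite place `v₁` of `F` is `ι_{v₁}(u)` for a `u ∈ U(J)(F_{v₁})` all of whose components have determinant `1`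
(`exists_inclPlaceAdelic_eq_units_transvection`) — an element of the normal subgroup `ι_{v₁}(SU(J)(F_{v₁}))` of the O8a road (★ p850597).
CONSUMER: the sequel `UnitaryGroupRankTwoStrongApproximation` (closure of `SU(J)(F) · ι_{v₁} SU(J)(F_{v₁})` contains every unitary adelic transvection by ★ `AdeleRing.exists_sub_algebraMap_sub_adeleSingleHom_mem`,
then every determinant-one element by the unit pivot).  HONEST LABEL: model plumbing ([PlatonovRapinchuk1994] §5.1, §7.4; [CasselsFrohlichANT1967] II §14–§15); HC_CM is proved only modulo
the printed citations of that programme until its rung 0 closes; this file proves no printed citation of it.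

## References
* [PlatonovRapinchuk1994] V. Platonov, A. Rapinchuk, *Algebraic Groups and Number Theory* (1994), §5.1, §7.1, §7.4 Thm. 7.12.
* [Kneser1966] M. Kneser, *Strong approximation*, Proc. Sympos. Pure Math. IX (1966) 187–196.
* [CasselsFrohlichANT1967] J. W. S. Cassels, A. Fröhlich (eds.), *Algebraic Number Theory* (1967), Ch. II §14–§15, Ch. VII §1.1.
* [BourbakiAlgebraI1989] N. Bourbaki, *Algebra I, Chapters 1–3* (1989), Ch. II §10 no. 13, Ch. III §8.
-/

set_option autoImplicit false

noncomputable section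

open Matrix NumberField IsDedekindDomain

namespace Literature.NumberTheory.Automorphic

/-! ## §1 Commutative-ring generalities: unitary transvections for `antidiag(1,1)` -/

namespace UnitaryOneOne

universe u

section CommRing

variable {R : Type u} [CommRing R] (σ : R →+* R)

/-- `ᵗ(σ [[a,b],[c,d]]) = [[σa, σc],[σb, σd]]` (plumbing). [folklore] -/
private theorem transpose_map_fin_two' (a b c d : R) :
    ((!![a, b; c, d]).map σ)ᵀ = !![σ a, σ c; σ b, σ d] := by
  ext i j
  fin_cases i <;> fin_cases j <;> rfl

/-- `T₀₁(x) = [[1, x],[0, 1]]` over a commutative ring (plumbing). [folklore] -/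
private theorem transvection_zero_one_eq' (x : R) : transvection (0 : Fin 2) 1 x = !![1, x; 0, 1] := by
  ext i j
  fin_cases i <;> fin_cases j <;> simp [transvection, Matrix.single]

/-- `T₁₀(y) = [[1, 0],[y, 1]]` over a commutative ring (plumbing). [folklore] -/
private theorem transvection_one_zero_eq' (y : R) : transvection (1 : Fin 2) 0 y = !![1, 0; y, 1] := by
  ext i j
  fin_cases i <;> fin_cases j <;> simp [transvection, Matrix.single]

/-- commutative-ring form of ★ `units_transvectionStruct_mem_of_map_eq_neg` (same computation; private: the public statements below are its adelic instances, the field case is ★).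
[cite: PlatonovRapinchuk1994, §7.1] -/
private theorem units_transvectionStruct_mem_unitaryGroupOfForm' {J : Matrix (Fin 2) (Fin 2) R} (hJ : J = !![0, 1; 1, 0]) (t : TransvectionStruct (Fin 2) R)
    (ht : σ t.c = -t.c) : (⟨t.toMatrix, t.inv.toMatrix, t.mul_inv, t.inv_mul⟩ : GL (Fin 2) R) ∈ unitaryGroupOfForm σ J := by
  subst hJ
  obtain ⟨i, j, hij, x⟩ := t
  rw [mem_unitaryGroupOfForm_iff]
  change ((transvection i j x).map σ)ᵀ * !![0, 1; 1, 0] * transvection i j x = !![0, 1; 1, 0]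
  change σ x = -x at ht
  fin_cases i <;> fin_cases j
  · exact absurd rfl hij
  · simp only [Fin.zero_eta, Fin.mk_one]
    rw [transvection_zero_one_eq', transpose_map_fin_two', Matrix.mul_fin_two, Matrix.mul_fin_two, map_one, map_zero, ht]
    ext a b
    fin_cases a <;> fin_cases b <;> simp
  · simp only [Fin.mk_one, Fin.zero_eta]
    rw [transvection_one_zero_eq', transpose_map_fin_two', Matrix.mul_fin_two, Matrix.mul_fin_two, map_one, map_zero, ht]
    ext a b
    fin_cases a <;> fin_cases b <;> simp
  · exact absurd rfl hij

/-- commutative-ring form of ★ `entries_of_mem_of_det_eq_one` (private; the public statement below is its adelic instance). [cite: PlatonovRapinchuk1994, §7.1] -/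
private theorem entries_of_mem_unitaryGroupOfForm_of_det_eq_one' {J : Matrix (Fin 2) (Fin 2) R} (hJ : J = !![0, 1; 1, 0]) {g : GL (Fin 2) R} (hg : g ∈ unitaryGroupOfForm σ J)
    (hdet : (g : Matrix (Fin 2) (Fin 2) R).det = 1) :
    σ ((g : Matrix (Fin 2) (Fin 2) R) 0 0) = (g : Matrix (Fin 2) (Fin 2) R) 0 0 ∧ σ ((g : Matrix (Fin 2) (Fin 2) R) 0 1) = -(g : Matrix (Fin 2) (Fin 2) R) 0 1 ∧
      σ ((g : Matrix (Fin 2) (Fin 2) R) 1 0) = -(g : Matrix (Fin 2) (Fin 2) R) 1 0 ∧ σ ((g : Matrix (Fin 2) (Fin 2) R) 1 1) = (g : Matrix (Fin 2) (Fin 2) R) 1 1 := by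
  subst hJ
  set a := (g : Matrix (Fin 2) (Fin 2) R) 0 0
  set b := (g : Matrix (Fin 2) (Fin 2) R) 0 1
  set c := (g : Matrix (Fin 2) (Fin 2) R) 1 0
  set d := (g : Matrix (Fin 2) (Fin 2) R) 1 1
  have hM : (g : Matrix (Fin 2) (Fin 2) R) = !![a, b; c, d] := Matrix.eta_fin_two _
  rw [mem_unitaryGroupOfForm_iff, hM, transpose_map_fin_two', Matrix.mul_fin_two, Matrix.mul_fin_two] at hg
  rw [hM, Matrix.det_fin_two_of] at hdet
  have h00 := congrArg (fun M : Matrix (Fin 2) (Fin 2) R => M 0 0) hg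
  have h01 := congrArg (fun M : Matrix (Fin 2) (Fin 2) R => M 0 1) hg
  have h10 := congrArg (fun M : Matrix (Fin 2) (Fin 2) R => M 1 0) hg
  have h11 := congrArg (fun M : Matrix (Fin 2) (Fin 2) R => M 1 1) hg
  simp only [of_apply, cons_val', cons_val_zero, cons_val_one, cons_val_fin_one, empty_val'] at h00 h01 h10 h11
  have e1 : a * σ c + c * σ a = 0 := by linear_combination h00
  have e2 : b * σ c + d * σ a = 1 := by linear_combination h01
  have e3 : a * σ d + c * σ b = 1 := by linear_combination h10
  have e4 : b * σ d + d * σ b = 0 := by linear_combination h11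
  refine ⟨?_, ?_, ?_, ?_⟩
  · linear_combination a * e2 - b * e1 - σ a * hdet
  · linear_combination a * e4 - b * e3 - σ b * hdet
  · linear_combination d * e1 - c * e2 - σ c * hdet
  · linear_combination d * e3 - c * e4 - σ d * hdet

/-- `det T_{ij}(x) = 1` for the unit attached to a `TransvectionStruct` (plumbing). [cite: BourbakiAlgebraI1989, Ch. III §8 no. 3 (multiplicativity of the determinant)] -/
theorem det_units_transvectionStruct (t : TransvectionStruct (Fin 2) R) :
    (((⟨t.toMatrix, t.inv.toMatrix, t.mul_inv, t.inv_mul⟩ : GL (Fin 2) R) : GL (Fin 2) R) : Matrix (Fin 2) (Fin 2) R).det = 1 := by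
  obtain ⟨i, j, hij, x⟩ := t
  exact det_transvection_of_ne i j hij x

/-- `(T_{ij}(x)).map f = T_{ij}(f x)` for a ring homomorphism `f` (plumbing). [cite: BourbakiAlgebraI1989, Ch. II §10 no. 13 (the matrices `B_{ij}(λ)`)] -/
theorem transvection_map {S : Type*} [CommRing S] (f : R →+* S) (i j : Fin 2) (x : R) :
    (transvection i j x).map f = transvection i j (f x) := by
  ext a b
  simp only [transvection, Matrix.map_apply, Matrix.add_apply, Matrix.one_apply, Matrix.single_apply, map_add]
  split_ifs <;> simp

end CommRing

section Topology

variable {R : Type u} [CommRing R] [TopologicalSpace R] [IsTopologicalRing R]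

/-- **`x ↦ T_{ij}(x)` is continuous into `GL₂(R)`** (unit-group topology: both `T_{ij}(x)` and its inverse `T_{ij}(−x)` depend continuously on `x`). [cite: PlatonovRapinchuk1994, §3.3] -/
theorem continuous_units_transvection (i j : Fin 2) (hij : i ≠ j) :
    Continuous fun x : R => (⟨(⟨i, j, hij, x⟩ : TransvectionStruct (Fin 2) R).toMatrix, (⟨i, j, hij, x⟩ : TransvectionStruct (Fin 2) R).inv.toMatrix,
      TransvectionStruct.mul_inv _, TransvectionStruct.inv_mul _⟩ : GL (Fin 2) R) := by
  have hT : ∀ (y : R → R), Continuous y → Continuous fun x : R => transvection i j (y x) := fun y hy => by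
    refine continuous_matrix fun a b => ?_
    simp only [transvection, Matrix.add_apply, Matrix.single_apply]
    by_cases h : i = a ∧ j = b
    · simp only [if_pos h]
      exact continuous_const.add hy
    · simp only [if_neg h]
      exact continuous_const.add continuous_const
  refine Units.continuous_iff.2 ⟨?_, ?_⟩
  · exact hT id continuous_id
  · change Continuous fun x : R => transvection i j (-x)
    exact hT _ continuous_neg

end Topology

end UnitaryOneOne

/-! ## §2 The adelic unitary group `U(antidiag(1,1))(𝔸_F) ≤ GL₂(𝔸_E)` -/

namespace UnitaryGroup

variable (F E : Type) [Field F] [NumberField F] [Field E] [NumberField E] [Algebra F E]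
variable (c : E ≃ₐ[F] E)

omit [NumberField F] in
/-- `antidiag(1,1)` over `𝔸_E` is `antidiag(1,1)` (plumbing). [folklore] -/
private theorem adelicForm_antidiag {J : Matrix (Fin 2) (Fin 2) E} (hJ2 : J = !![0, 1; 1, 0]) :
    adelicForm E 2 J = !![0, 1; 1, 0] := by
  subst hJ2
  ext i j
  fin_cases i <;> fin_cases j <;> simp [adelicForm, Matrix.map_apply]

omit [NumberField F] in
/-- **A unitary adelic transvection**: for `z ∈ 𝔸_E` with `(c ⊗ 1) z = −z`, the unit `T_{ij}(z)` of `GL₂(𝔸_E)` lies in `U(J)(𝔸_F)`, `J = antidiag(1,1)` (★ `adelic`).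
[cite: PlatonovRapinchuk1994, §5.1; §7.1] -/
theorem units_transvection_mem_adelic {J : Matrix (Fin 2) (Fin 2) E} (hJ2 : J = !![0, 1; 1, 0]) (t : TransvectionStruct (Fin 2) (AdeleRing (𝓞 E) E))
    (ht : conjAdele F E c t.c = -t.c) :
    (⟨t.toMatrix, t.inv.toMatrix, t.mul_inv, t.inv_mul⟩ : GL (Fin 2) (AdeleRing (𝓞 E) E)) ∈ adelic F E c 2 J :=
  UnitaryOneOne.units_transvectionStruct_mem_unitaryGroupOfForm' (conjAdele F E c) (adelicForm_antidiag E hJ2) t ht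

omit [NumberField F] in
/-- **Entries of a determinant-one element of `U(J)(𝔸_F)`, `J = antidiag(1,1)`**: for `g = (a b; c d) ∈ U(J)(𝔸_F) ≤ GL₂(𝔸_E)` with `det g = 1`, `(c ⊗ 1) a = a`, `(c ⊗ 1) b = −b`,
`(c ⊗ 1) c = −c`, `(c ⊗ 1) d = d` (the adele-ring instance of ★ `UnitaryOneOne.entries_of_mem_of_det_eq_one`; same `2 × 2` computation, valid over any commutative ring).
[cite: PlatonovRapinchuk1994, §7.1; §5.1] -/
theorem entries_of_mem_adelic_of_det_eq_one {J : Matrix (Fin 2) (Fin 2) E} (hJ2 : J = !![0, 1; 1, 0]) {g : GL (Fin 2) (AdeleRing (𝓞 E) E)} (hg : g ∈ adelic F E c 2 J)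
    (hdet : (g : Matrix (Fin 2) (Fin 2) (AdeleRing (𝓞 E) E)).det = 1) :
    conjAdele F E c ((g : Matrix (Fin 2) (Fin 2) (AdeleRing (𝓞 E) E)) 0 0) = (g : Matrix (Fin 2) (Fin 2) (AdeleRing (𝓞 E) E)) 0 0 ∧
      conjAdele F E c ((g : Matrix (Fin 2) (Fin 2) (AdeleRing (𝓞 E) E)) 0 1) = -(g : Matrix (Fin 2) (Fin 2) (AdeleRing (𝓞 E) E)) 0 1 ∧
      conjAdele F E c ((g : Matrix (Fin 2) (Fin 2) (AdeleRing (𝓞 E) E)) 1 0) = -(g : Matrix (Fin 2) (Fin 2) (AdeleRing (𝓞 E) E)) 1 0 ∧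
      conjAdele F E c ((g : Matrix (Fin 2) (Fin 2) (AdeleRing (𝓞 E) E)) 1 1) = (g : Matrix (Fin 2) (Fin 2) (AdeleRing (𝓞 E) E)) 1 1 :=
  UnitaryOneOne.entries_of_mem_unitaryGroupOfForm_of_det_eq_one' (conjAdele F E c) (adelicForm_antidiag E hJ2) hg hdet

omit [NumberField F] in
/-- **Rational unitary transvections**: for `q ∈ E` with `c q = −q`, `T_{ij}(q) ∈ U(J)(F)` (★ `rational`, ★ p850490) and its image under ★ `toAdelic` is the adelic transvection `T_{ij}(q ⊗ 1)`
(on underlying matrices `toAdelic` is `GL₂(algebraMap E 𝔸_E)`, ★ `coe_unitaryGroupOfFormMap`). [cite: PlatonovRapinchuk1994, §5.1] -/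
theorem coe_toAdelic_units_transvection {J : Matrix (Fin 2) (Fin 2) E} (hJ2 : J = !![0, 1; 1, 0]) (i j : Fin 2) (hij : i ≠ j) (q : E) (hq : c q = -q) :
    ((toAdelic F E c 2 J ⟨⟨(⟨i, j, hij, q⟩ : TransvectionStruct (Fin 2) E).toMatrix, (⟨i, j, hij, q⟩ : TransvectionStruct (Fin 2) E).inv.toMatrix,
        TransvectionStruct.mul_inv _, TransvectionStruct.inv_mul _⟩,
        UnitaryOneOne.units_transvectionStruct_mem_of_map_eq_neg (c : E →+* E) hJ2 ⟨i, j, hij, q⟩ hq⟩ : adelic F E c 2 J) : GL (Fin 2) (AdeleRing (𝓞 E) E)) =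
      ⟨(⟨i, j, hij, algebraMap E (AdeleRing (𝓞 E) E) q⟩ : TransvectionStruct (Fin 2) (AdeleRing (𝓞 E) E)).toMatrix,
        (⟨i, j, hij, algebraMap E (AdeleRing (𝓞 E) E) q⟩ : TransvectionStruct (Fin 2) (AdeleRing (𝓞 E) E)).inv.toMatrix, TransvectionStruct.mul_inv _, TransvectionStruct.inv_mul _⟩ := by
  refine Units.ext ?_
  change (algebraMap E (AdeleRing (𝓞 E) E)).mapMatrix (transvection i j q) = transvection i j (algebraMap E (AdeleRing (𝓞 E) E) q)
  rw [RingHom.mapMatrix_apply]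
  exact UnitaryOneOne.transvection_map _ i j q

omit [NumberField F] in
/-- `(c ⊗ 1)(q ⊗ 1) = −(q ⊗ 1)` for `c q = −q` (★ `algebraMap_conj`). [cite: CasselsFrohlichANT1967, Ch. VII §1.1] -/
theorem conjAdele_algebraMap_of_map_eq_neg {q : E} (hq : c q = -q) :
    conjAdele F E c (algebraMap E (AdeleRing (𝓞 E) E) q) = -algebraMap E (AdeleRing (𝓞 E) E) q := by
  rw [← algebraMap_conj]
  change algebraMap E (AdeleRing (𝓞 E) E) (c q) = _
  rw [hq, map_neg]

omit [NumberField F] in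
/-- **Rational unitary transvections lie in the image of `toAdelic` restricted to `SU(J)(F)`**: for `q ∈ E` with `c q = −q` the adelic transvection `T_{ij}(q ⊗ 1)` is `toAdelic γ` for a
rational `γ` of determinant `1`. [cite: PlatonovRapinchuk1994, §5.1] -/
theorem units_transvection_algebraMap_mem_image_toAdelic {J : Matrix (Fin 2) (Fin 2) E} (hJ2 : J = !![0, 1; 1, 0]) (i j : Fin 2) (hij : i ≠ j) (q : E) (hq : c q = -q) :
    (⟨⟨(⟨i, j, hij, algebraMap E (AdeleRing (𝓞 E) E) q⟩ : TransvectionStruct (Fin 2) (AdeleRing (𝓞 E) E)).toMatrix,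
        (⟨i, j, hij, algebraMap E (AdeleRing (𝓞 E) E) q⟩ : TransvectionStruct (Fin 2) (AdeleRing (𝓞 E) E)).inv.toMatrix, TransvectionStruct.mul_inv _, TransvectionStruct.inv_mul _⟩,
        units_transvection_mem_adelic F E c hJ2 ⟨i, j, hij, _⟩ (conjAdele_algebraMap_of_map_eq_neg F E c hq)⟩ : adelic F E c 2 J) ∈
      toAdelic F E c 2 J '' {γ : rational F E c 2 J | ((γ : GL (Fin 2) E) : Matrix (Fin 2) (Fin 2) E).det = 1} :=
  ⟨⟨⟨(⟨i, j, hij, q⟩ : TransvectionStruct (Fin 2) E).toMatrix, (⟨i, j, hij, q⟩ : TransvectionStruct (Fin 2) E).inv.toMatrix, TransvectionStruct.mul_inv _, TransvectionStruct.inv_mul _⟩,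
      UnitaryOneOne.units_transvectionStruct_mem_of_map_eq_neg (c : E →+* E) hJ2 ⟨i, j, hij, q⟩ hq⟩,
    det_transvection_of_ne i j hij q, Subtype.ext (coe_toAdelic_units_transvection F E c hJ2 i j hij q hq)⟩


/-! ## §3 Unitary adelic transvections supported over one finite place -/

/-- **A unitary adelic transvection with parameter supported over the finite place `v₁` of `F` is `ι_{v₁}` of a determinant-one element of `U(J)(F_{v₁})`.**  For `z ∈ 𝔸_E` with
`(c ⊗ 1) z = −z`, no archimedean component (`z.1 = 0`) and `z_w = 0` at every finite place `w` of `E` not above `v₁`, there is `u ∈ U(J)(F_{v₁})` (Π-model ★ `localPi`), all of whose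
components have determinant `1`, with `inclPlaceAdelic v₁ u = T_{ij}(z)`.  (`u := evalPlace v₁ (finPart T(z))`; the archimedean part of `T(z)` is `T(z_∞) = 1` and its components off `v₁`
are `T(z_w) = T(0) = 1`, ★ `archToAdelic_mul_finAdelicToAdelic`, ★ `eq_of_forall_evalPlace_eq`; each component over `v₁` is the transvection `T(z_w)` of determinant `1`.)
[cite: PlatonovRapinchuk1994, §5.1] [cite: CasselsFrohlichANT1967, Ch. II §14] -/
theorem exists_inclPlaceAdelic_eq_units_transvection {J : Matrix (Fin 2) (Fin 2) E} (hJ2 : J = !![0, 1; 1, 0]) (v₁ : HeightOneSpectrum (𝓞 F)) (i j : Fin 2) (hij : i ≠ j)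
    (z : AdeleRing (𝓞 E) E) (hz : conjAdele F E c z = -z) (hz1 : z.1 = 0) (hz2 : ∀ w : HeightOneSpectrum (𝓞 E), w.under (𝓞 F) ≠ v₁ → z.2 w = 0) :
    ∃ u : ↥(localPi E c 2 J v₁),
      (∀ w : PlacesOver E v₁, (((u : LocalGLPi E 2 v₁) w : GL (Fin 2) (w.1.adicCompletion E)) : Matrix (Fin 2) (Fin 2) (w.1.adicCompletion E)).det = 1) ∧
      inclPlaceAdelic F E c 2 J v₁ u =
        ⟨⟨(⟨i, j, hij, z⟩ : TransvectionStruct (Fin 2) (AdeleRing (𝓞 E) E)).toMatrix, (⟨i, j, hij, z⟩ : TransvectionStruct (Fin 2) (AdeleRing (𝓞 E) E)).inv.toMatrix,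
          TransvectionStruct.mul_inv _, TransvectionStruct.inv_mul _⟩, units_transvection_mem_adelic F E c hJ2 ⟨i, j, hij, z⟩ hz⟩ := by
  set g : (adelicGroupData F E c 2 J).Adelic :=
    ⟨⟨(⟨i, j, hij, z⟩ : TransvectionStruct (Fin 2) (AdeleRing (𝓞 E) E)).toMatrix, (⟨i, j, hij, z⟩ : TransvectionStruct (Fin 2) (AdeleRing (𝓞 E) E)).inv.toMatrix,
      TransvectionStruct.mul_inv _, TransvectionStruct.inv_mul _⟩, units_transvection_mem_adelic F E c hJ2 ⟨i, j, hij, z⟩ hz⟩ with hg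
  -- the component of `T(z)` at a finite place `w` of `E` is the transvection `T(z_w)`
  have hcomp : ∀ (v : HeightOneSpectrum (𝓞 F)) (w : PlacesOver E v),
      (((evalPlace F E c 2 J v (finPart F E c 2 J g) : LocalGLPi E 2 v) w : GL (Fin 2) (w.1.adicCompletion E)) : Matrix (Fin 2) (Fin 2) (w.1.adicCompletion E)) =
        transvection i j (z.2 w.1) := by
    intro v w
    rw [coe_evalPlace_apply]
    change ((AdelicGroupData.finiteAdeleEval E w.1).comp (RingHom.snd (InfiniteAdeleRing E) (FiniteAdeleRing (𝓞 E) E))).mapMatrix (transvection i j z) = _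
    rw [RingHom.mapMatrix_apply, UnitaryOneOne.transvection_map]
    rfl
  refine ⟨evalPlace F E c 2 J v₁ (finPart F E c 2 J g), fun w => ?_, ?_⟩
  · rw [hcomp]
    exact det_transvection_of_ne i j hij _
  · -- archimedean part `T(z_∞) = 1`
    have harch : archPart F E c 2 J g = 1 := by
      refine Subtype.ext ?_
      rw [coe_archPart, OneMemClass.coe_one, GLn.toMixed_apply]
      have h1 : GLn.fstHom 2 E (adelicVal F E c 2 J g) = 1 := by
        refine Units.ext ?_
        change (RingHom.fst (InfiniteAdeleRing E) (FiniteAdeleRing (𝓞 E) E)).mapMatrix (transvection i j z) = 1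
        rw [RingHom.mapMatrix_apply, UnitaryOneOne.transvection_map, RingHom.coe_fst, hz1, transvection_zero]
      rw [h1, map_one]
    -- finite part `= inclPlace v₁ u`
    have hfin : finPart F E c 2 J g = inclPlace F E c 2 J v₁ (evalPlace F E c 2 J v₁ (finPart F E c 2 J g)) := by
      refine eq_of_forall_evalPlace_eq F E c 2 J fun v => ?_
      by_cases hv : v = v₁
      · subst hv
        rw [evalPlace_inclPlace]
      · rw [evalPlace_inclPlace_of_ne F E c 2 J hv]
        refine Subtype.ext (funext fun w => Units.ext ?_)
        rw [hcomp v w, hz2 w.1 (by rw [w.2]; exact hv), transvection_zero]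
        rfl
    calc inclPlaceAdelic F E c 2 J v₁ (evalPlace F E c 2 J v₁ (finPart F E c 2 J g))
        = archToAdelic F E c 2 J (archPart F E c 2 J g) * finAdelicToAdelic F E c 2 J (finPart F E c 2 J g) := by
          rw [harch, map_one, one_mul, inclPlaceAdelic_apply, ← hfin]
      _ = g := archToAdelic_mul_finAdelicToAdelic F E c 2 J g

end UnitaryGroup

end Literature.NumberTheory.Automorphic

end
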